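import Literature.Geometry.Lorentzian.TeukolskyOffConeSupBoundsBox
import Literature.Geometry.Lorentzian.CarterHorizonPocketLowLambda
import HarnessLib

/-!
# A global envelope of `R_𝓘` at bounded off-cone frequencies, uniform up to extremality, INCLUDING
# the axisymmetric low-`Λ` window (`Kerr.axisymmetricLowLambda_infinityEnvelope`)

(namespace `Literature.Geometry.Lorentzian.Kerr`.) Companion of `TeukolskyOffConeSupBounds{,Box}.lean`.
There the three-zone argument (far envelope, κ-uniform middle-zone transport, conjugate-basis transfer
against the `|ξ| ≥ 1` pocket of `u_𝓗`) gives, for `0 < M`, `0 < ε₀`, `0 < ω_l`, constants `a₁ < M` and ONE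
`P` with `(r² + a²)^{1/2}|R_𝓘(r)| ≤ P` for ALL `r > r₊`, all `a₁ ≤ |a| < M` and all admissible off-cone
triples in the window `ω_l ≤ |ω| ≤ ω_h`, `Λ ≤ Λ_h` — EXCEPT in the axisymmetric low-`Λ` window `m = 0`,
`Λ < 1`, excluded only by the cosmetic hypothesis `Λ ≥ 1` of the pocket lemma
`Kerr.horizonPocket_weightedNormSq_le`. With the pocket re-run against an angular ceiling
(`Kerr.horizonPocket_weightedNormSq_le_lowLambda`, `Φ = ω² + 6Λ₁/M²`, `Λ₁ ≥ max(Λ, 1)`) the SAME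
assembly covers all admissible off-cone triples in the window:

* `horizonPocket_tortoise_lowLambda` — the pocket in the tortoise variable, box form, no `Λ ≥ 1`;
* `offCone_infinityEnvelope_of_constants_lowLambda` — the assembly for given constants, no `Λ ≥ 1`;
* `offCone_infinityEnvelope_all` — `∃ a₁ < M, P` for all off-cone window triples (no `m ≠ 0 ∨ Λ ≥ 1`);
* `axisymmetricLowLambda_infinityEnvelope` — the axisymmetric low-`Λ` window `m = 0`, `Λ < 1` in the
  format consumed by the near-extremal integrated-decay programme (crux `KappaExplicitWaveDecay`,
  `AxisymmetricLowLambdaEnvelope` of the S6a′ skeleton; DRSR Prop. 9.7.1 off the cone).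
No loss in `κ`; everything is proved.

## References
* M. Dafermos, I. Rodnianski, Y. Shlapentokh-Rothman, arXiv:1402.7034, §8, Prop. 9.7.1.
  [DafermosRodnianskiShlapentokhrothman2014]
* R. Teixeira da Costa, CMP 378 (2020), Def. 2.3, Prop. 2.20. [Costa2019]
-/

noncomputable section

open Complex Set Filter Topology
open scoped ComplexConjugate

namespace Literature.Geometry.Lorentzian.Kerr

/-- **The `|ξ| ≥ 1` pocket in the tortoise variable, box form, no `Λ ≥ 1`.** Under the hypotheses of
`Kerr.horizonPocket_weightedNormSq_le_lowLambda` (pocket parameter `c₁`, `r₊ − r₋ ≤ |σ|(r₊² + a²)`,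
`Λ ≤ Λ₁`, `1 ≤ Λ₁`), if the pocket ratio `(ω² + 6Λ₁/M²)/(σ²/800)` is `≤ ρ₀` and `|σ| ≤ σ₁`, then at
every `z` with `ρ z − r₊ ≤ c₁|σ|(r₊² + a²)` and `ρ z − r₊ ≤ M`: `(ρ(z)² + a²)^{1/2}|R_𝓗(ρ z)| ≤ 49ρ₀⁴` and
the tortoise derivative satisfies `|u_𝓗′(z)| ≤ √3σ₁ρ₀⁴`. [cite: DafermosRodnianskiShlapentokhrothman2014, §8] -/
theorem horizonPocket_tortoise_lowLambda {M a ω Λ Λ₁ c₁ ρ₀ σ₁ : ℝ} {m : ℤ} (hM : 0 < M) (ha : |a| < M)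
    (hadm : IsAdmissibleTriple a ω m Λ) (hΛ : Λ ≤ Λ₁) (h1 : 1 ≤ Λ₁) (hc₀ : 0 < c₁) (hc₁ : c₁ ≤ 1)
    (hcω : 10 * M * |ω| * c₁ ≤ 1) (hcΛ : 16 * (2 * Λ + 3) * c₁ ≤ 1)
    (hσ : rPlus M a - rMinus M a ≤ |ω - m * horizonAngularVelocity M a| * (rPlus M a ^ 2 + a ^ 2))
    {RH : ℝ → ℂ} (hRH : IsRadialTeukolskySolution M a 0 ω m (Λ - a ^ 2 * ω ^ 2) RH)
    (hnH : IsNormalisedHorizonSolution M a 0 ω m RH) {ρ : ℝ → ℝ} (hρ : IsTortoiseRadius M a ρ)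
    {uH₁ : ℝ → ℂ} (huH₁ : ∀ z, uH₁ z = ((delta M a (ρ z) / (ρ z ^ 2 + a ^ 2) : ℝ) : ℂ) *
      deriv (fun s : ℝ ↦ ((Real.sqrt (s ^ 2 + a ^ 2) : ℝ) : ℂ) * RH s) (ρ z))
    (hratio : (ω ^ 2 + 6 * Λ₁ / M ^ 2) / ((ω - m * horizonAngularVelocity M a) ^ 2 / 800) ≤ ρ₀)
    (hσσ₁ : |ω - m * horizonAngularVelocity M a| ≤ σ₁) {z : ℝ}
    (hz : ρ z - rPlus M a ≤ c₁ * |ω - m * horizonAngularVelocity M a| * (rPlus M a ^ 2 + a ^ 2))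
    (hzM : ρ z - rPlus M a ≤ M) :
    Real.sqrt (ρ z ^ 2 + a ^ 2) * ‖RH (ρ z)‖ ≤ 49 * ρ₀ ^ 4 ∧ ‖uH₁ z‖ ≤ Real.sqrt 3 * σ₁ * ρ₀ ^ 4 := by
  have hMa : IsSubextremal M a := ha
  have h := horizonPocket_weightedNormSq_le_lowLambda hM ha hadm hΛ h1 hc₀ hc₁ hcω hcΛ hσ hRH hnH
    (hρ.rPlus_lt z) hz hzM
  have hratio0 : 0 ≤ (ω ^ 2 + 6 * Λ₁ / M ^ 2) / ((ω - m * horizonAngularVelocity M a) ^ 2 / 800) := by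
    have : 0 ≤ Λ₁ := zero_le_one.trans h1
    positivity
  have hρ₀0 : 0 ≤ ρ₀ := hratio0.trans hratio
  have h8 := pow_le_pow_left₀ hratio0 hratio 8
  constructor
  · have h1' : (Real.sqrt (ρ z ^ 2 + a ^ 2) * ‖RH (ρ z)‖) ^ 2 ≤ (49 * ρ₀ ^ 4) ^ 2 := by
      calc _ ≤ _ := h.1
        _ ≤ 2400 * ρ₀ ^ 8 := by gcongr
        _ ≤ (49 * ρ₀ ^ 4) ^ 2 := by nlinarith [pow_nonneg hρ₀0 8]
    exact (pow_le_pow_iff_left₀ (by positivity) (by positivity) two_ne_zero).1 h1'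
  · rw [huH₁ z, norm_mul, Complex.norm_real, Real.norm_eq_abs, abs_of_pos (hρ.deriv_pos hMa z)]
    have hσ0 : 0 ≤ σ₁ := (abs_nonneg _).trans hσσ₁
    have h1' : (delta M a (ρ z) / (ρ z ^ 2 + a ^ 2) *
        ‖deriv (fun s : ℝ ↦ ((Real.sqrt (s ^ 2 + a ^ 2) : ℝ) : ℂ) * RH s) (ρ z)‖) ^ 2 ≤
        (Real.sqrt 3 * σ₁ * ρ₀ ^ 4) ^ 2 := by
      calc _ ≤ _ := h.2
        _ ≤ 3 * σ₁ ^ 2 * ρ₀ ^ 8 := by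
            have hσ2 : (ω - m * horizonAngularVelocity M a) ^ 2 ≤ σ₁ ^ 2 := by
              rw [← sq_abs]; exact pow_le_pow_left₀ (abs_nonneg _) hσσ₁ 2
            exact mul_le_mul (by nlinarith) h8 (by positivity) (by positivity)
        _ = (Real.sqrt 3 * σ₁ * ρ₀ ^ 4) ^ 2 := by
            rw [mul_pow, mul_pow, Real.sq_sqrt (by norm_num : (0 : ℝ) ≤ 3)]; ring
    have hΔ : 0 ≤ delta M a (ρ z) / (ρ z ^ 2 + a ^ 2) := (hρ.deriv_pos hMa z).le
    exact (pow_le_pow_iff_left₀ (by positivity) (by positivity) two_ne_zero).1 h1'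

set_option maxHeartbeats 400000 in
/-- **Global envelope of the infinity-normalised solution, for GIVEN constants, no `Λ ≥ 1`** (`s = 0`):
the three-zone argument of `Kerr.offCone_infinityEnvelope_of_constants` (far envelope, κ-uniform
middle-zone transport, conjugate-basis transfer against the `|ξ| ≥ 1` pocket of `u_𝓗`) with the pocket
ratio measured against the angular CEILING `Λ₁ ≥ 1` (`horizonPocket_tortoise_lowLambda`), so that the
hypothesis `1 ≤ Λ` of the original disappears. Constants: `σ₀` (floor of `|σ|`), `ω_h′`, `Λ₁ ≥ 1`,
`σ₁ ≥ ω_h′ + √Λ₁/2M`, `c₁`, `ℓ₀ ≤ c₁σ₀M²`, `ρ₀ ≥ (ω_h′² + 6Λ₁/M²)/(σ₀²/800)`, `R_F`, `K`, `L₀` with their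
defining inequalities. For every `|a| < M` with `2√(M² − a²) ≤ σ₀M²`, every admissible triple with
`σ₀ ≤ |ω − mω₊|`, `ω_l ≤ |ω| ≤ ω_h′`, `Λ ≤ Λ₁`, every normalised pair and every `r > r₊`:
`(r² + a²)^{1/2}|R_𝓘(r)| ≤ P`. [cite: DafermosRodnianskiShlapentokhrothman2014, Prop. 9.7.1] -/
theorem offCone_infinityEnvelope_of_constants_lowLambda {M σ₀ ωl ωh' Λ₁ σ₁ c₁ ℓ₀ ρ₀ RF K L₀ : ℝ}
    (hM : 0 < M) (hσ₀0 : 0 < σ₀) (hωl : 0 < ωl) (hωh'0 : 0 < ωh') (hΛ₁1 : 1 ≤ Λ₁)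
    (hσ₁ : ωh' + Real.sqrt Λ₁ / (2 * M) ≤ σ₁) (hc₀ : 0 < c₁) (hc₁ : c₁ ≤ 1)
    (hcω₁ : 10 * M * ωh' * c₁ ≤ 1) (hcΛ₁ : 16 * (2 * Λ₁ + 3) * c₁ ≤ 1) (hcσ₁ : 8 * M * σ₁ * c₁ ≤ 1)
    (hℓ₀0 : 0 < ℓ₀) (hℓ₀ : ℓ₀ ≤ c₁ * σ₀ * M ^ 2)
    (hρ₀ : (ωh' ^ 2 + 6 * Λ₁ / M ^ 2) / (σ₀ ^ 2 / 800) ≤ ρ₀) (hRF7 : 7 * M ≤ RF)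
    (hRFΛ : Real.sqrt (12 * Λ₁) / ωl ≤ RF) (hRFω : 1 / (M * ωl ^ 2) ≤ RF) (hK0 : 0 ≤ K)
    (hK2 : ωh' ^ 2 + 3 * Λ₁ / M ^ 2 + 3 / M ^ 2 ≤ K ^ 2) (hL₀0 : 0 < L₀)
    (hL₀ : RF * (RF ^ 2 + M ^ 2) / ℓ₀ ^ 2 ≤ L₀) :
    ∃ P : ℝ, 0 < P ∧ ∀ a : ℝ, |a| < M → 2 * Real.sqrt (M ^ 2 - a ^ 2) ≤ σ₀ * M ^ 2 →
      ∀ (ω : ℝ) (m : ℤ) (Λ : ℝ), IsAdmissibleTriple a ω m Λ →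
        σ₀ ≤ |ω - m * horizonAngularVelocity M a| →
        ωl ≤ |ω| → |ω| ≤ ωh' → Λ ≤ Λ₁ →
        ∀ RH RI : ℝ → ℂ,
          IsRadialTeukolskySolution M a 0 ω m (Λ - a ^ 2 * ω ^ 2) RH →
          IsNormalisedHorizonSolution M a 0 ω m RH →
          IsRadialTeukolskySolution M a 0 ω m (Λ - a ^ 2 * ω ^ 2) RI →
          IsNormalisedInfinitySolution M 0 ω RI →
            ∀ r : ℝ, rPlus M a < r → Real.sqrt (r ^ 2 + a ^ 2) * ‖RI r‖ ≤ P := by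
  have hΛ₁0 : 0 ≤ Λ₁ := zero_le_one.trans hΛ₁1
  have hσ₁0 : 0 < σ₁ := lt_of_lt_of_le (by positivity) hσ₁
  have hρ₀0 : 0 ≤ ρ₀ := le_trans (by positivity) hρ₀
  have hRF0 : 0 < RF := lt_of_lt_of_le (by positivity) hRF7
  -- the constants of the three zones
  obtain ⟨E, hE⟩ : ∃ E : ℝ, Real.exp (max (K * L₀) 1) = E := ⟨_, rfl⟩
  have hE0 : 0 < E := by rw [← hE]; exact Real.exp_pos _
  obtain ⟨Pm, hPm⟩ : ∃ P : ℝ, (2 + L₀ * (Real.sqrt 2 * ωh')) * E = P := ⟨_, rfl⟩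
  obtain ⟨Pm', hPm'⟩ : ∃ P : ℝ, (max K L₀⁻¹ * 2 + Real.sqrt 2 * ωh') * E = P := ⟨_, rfl⟩
  have hmax0 : 0 ≤ max K L₀⁻¹ := hK0.trans (le_max_left _ _)
  have hPm0 : 0 ≤ Pm := by rw [← hPm]; positivity
  have hPm'0 : 0 ≤ Pm' := by rw [← hPm']; positivity
  obtain ⟨PH, hPH⟩ : ∃ P : ℝ, 49 * ρ₀ ^ 4 = P := ⟨_, rfl⟩
  obtain ⟨PH', hPH'⟩ : ∃ P : ℝ, Real.sqrt 3 * σ₁ * ρ₀ ^ 4 = P := ⟨_, rfl⟩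
  have hPH0 : 0 ≤ PH := by rw [← hPH]; positivity
  have hPH'0 : 0 ≤ PH' := by rw [← hPH']; positivity
  obtain ⟨Ph, hPh⟩ : ∃ P : ℝ, (Pm * PH' + Pm' * PH) / σ₀ * PH = P := ⟨_, rfl⟩
  have hPh0 : 0 ≤ Ph := by rw [← hPh]; positivity
  refine ⟨max 2 (max Pm Ph), lt_of_lt_of_le two_pos (le_max_left _ _), ?_⟩
  intro a ha hext ω m Λ hadm hσε hωl' hωh Λh RH RI hRH hnH hRI hnI r hr
  have hMa : IsSubextremal M a := ha
  obtain ⟨-, -, -, hAM, hA8, hMr, hr2⟩ := kerr_box_geometry hM ha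
  -- frequencies
  have hσ0 : 0 < |ω - m * horizonAngularVelocity M a| := hσ₀0.trans_le hσε
  have hσne : ω - m * horizonAngularVelocity M a ≠ 0 := abs_pos.1 hσ0
  have hω0 : ω ≠ 0 := abs_pos.1 (hωl.trans_le hωl')
  have hmΛ : |(m : ℝ)| ≤ Real.sqrt Λ₁ := Real.abs_le_sqrt (hadm.sq_le.trans Λh)
  have hσσ₁ : |ω - m * horizonAngularVelocity M a| ≤ σ₁ := by
    have hωp : |horizonAngularVelocity M a| ≤ 1 / (2 * M) := abs_horizonAngularVelocity_le hM ha.le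
    calc |ω - m * horizonAngularVelocity M a| ≤ |ω| + |(m : ℝ) * horizonAngularVelocity M a| :=
          abs_sub _ _
      _ = |ω| + |(m : ℝ)| * |horizonAngularVelocity M a| := by rw [abs_mul]
      _ ≤ ωh' + Real.sqrt Λ₁ * (1 / (2 * M)) :=
          add_le_add hωh (mul_le_mul hmΛ hωp (abs_nonneg _) (Real.sqrt_nonneg _))
      _ ≤ σ₁ := by rw [← div_eq_mul_one_div]; exact hσ₁
  -- the pocket width `ℓ = c₁|σ|(r₊² + a²) ∈ [ℓ₀, M]`
  obtain ⟨ℓ, hℓ⟩ : ∃ ℓ : ℝ, c₁ * |ω - m * horizonAngularVelocity M a| * (rPlus M a ^ 2 + a ^ 2) = ℓ :=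
    ⟨_, rfl⟩
  have hℓℓ₀ : ℓ₀ ≤ ℓ := by
    rw [← hℓ]
    exact hℓ₀.trans (mul_le_mul (mul_le_mul_of_nonneg_left hσε hc₀.le) hAM (by positivity)
      (by positivity))
  have hℓ0 : 0 < ℓ := hℓ₀0.trans_le hℓℓ₀
  have hℓM : ℓ ≤ M := by
    calc ℓ ≤ c₁ * σ₁ * (8 * M ^ 2) := by
          rw [← hℓ]; exact mul_le_mul (mul_le_mul_of_nonneg_left hσσ₁ hc₀.le) hA8 (by positivity)
            (by positivity)
      _ = (8 * M * σ₁ * c₁) * M := by ring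
      _ ≤ 1 * M := mul_le_mul_of_nonneg_right hcσ₁ hM.le
      _ = M := one_mul M
  -- near-extremality: `r₊ − r₋ = 2√(M² − a²) ≤ σ₀ M² ≤ |σ|(r₊² + a²)`
  have hσA : rPlus M a - rMinus M a ≤ |ω - m * horizonAngularVelocity M a| * (rPlus M a ^ 2 + a ^ 2) := by
    rw [rPlus_sub_rMinus]
    exact hext.trans (mul_le_mul hσε hAM (by positivity) hσ0.le)
  -- pocket hypotheses on `c₁` and the ratio ceiling
  have hcω : 10 * M * |ω| * c₁ ≤ 1 :=
    (mul_le_mul_of_nonneg_right (mul_le_mul_of_nonneg_left hωh (by positivity)) hc₀.le).trans hcω₁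
  have hcΛ : 16 * (2 * Λ + 3) * c₁ ≤ 1 :=
    (mul_le_mul_of_nonneg_right (mul_le_mul_of_nonneg_left (by linarith only [Λh]) (by norm_num))
      hc₀.le).trans hcΛ₁
  have hratio : (ω ^ 2 + 6 * Λ₁ / M ^ 2) / ((ω - m * horizonAngularVelocity M a) ^ 2 / 800) ≤ ρ₀ := by
    refine le_trans (div_le_div₀ (by positivity) ?_ (by positivity) ?_) hρ₀
    · have hω2 : ω ^ 2 ≤ ωh' ^ 2 := by
        rw [← sq_abs ω]; exact pow_le_pow_left₀ (abs_nonneg ω) hωh 2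
      exact add_le_add hω2 le_rfl
    · have : σ₀ ^ 2 ≤ (ω - m * horizonAngularVelocity M a) ^ 2 := by
        rw [← sq_abs (ω - _)]; exact pow_le_pow_left₀ hσ₀0.le hσε 2
      exact div_le_div_of_nonneg_right this (by norm_num)
  /- ### the tortoise variable -/
  obtain ⟨ρ, hρ⟩ := exists_isTortoiseRadius hMa
  obtain ⟨x, hx⟩ := hρ.exists_apply_eq hr
  obtain ⟨x₀, hx₀⟩ := hρ.exists_apply_eq (lt_add_of_pos_right _ hℓ0)
  have hRFr : rPlus M a < RF := by linarith only [hr2, hRF7, hM]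
  obtain ⟨xF, hxF⟩ := hρ.exists_apply_eq hRFr
  have hmono := (hρ.strictMono hMa).monotone
  have hx₀F : x₀ < xF := by
    rw [← (hρ.strictMono hMa).lt_iff_lt, hx₀, hxF]; linarith only [hr2, hℓM, hRF7, hM]
  -- `u_𝓘`, `u_𝓗` and their tortoise derivatives
  obtain ⟨uI₁, uI₂, hSI⟩ := schrodingerForm hM ha hRI hρ
  obtain ⟨uH₁, uH₂, hSH⟩ := schrodingerForm hM ha hRH hρ
  set uI : ℝ → ℂ := fun z ↦ ((Real.sqrt (ρ z ^ 2 + a ^ 2) : ℝ) : ℂ) * RI (ρ z) with huI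
  set uH : ℝ → ℂ := fun z ↦ ((Real.sqrt (ρ z ^ 2 + a ^ 2) : ℝ) : ℂ) * RH (ρ z) with huH
  have hIpair : ∀ z, HasDerivAt uI (uI₁ z) z ∧
      HasDerivAt uI₁ (-(((ω ^ 2 - sepPotential M a ω m Λ (ρ z) : ℝ) : ℂ) * uI z)) z := fun z ↦ by
    obtain ⟨h1, h2, h3, -⟩ := hSI z
    exact ⟨h1, by rw [← eq_neg_of_add_eq_zero_left h3]; exact h2⟩
  have hHpair : ∀ z, HasDerivAt uH (uH₁ z) z ∧
      HasDerivAt uH₁ (-(((ω ^ 2 - sepPotential M a ω m Λ (ρ z) : ℝ) : ℂ) * uH z)) z := fun z ↦ by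
    obtain ⟨h1, h2, h3, -⟩ := hSH z
    exact ⟨h1, by rw [← eq_neg_of_add_eq_zero_left h3]; exact h2⟩
  have hnormI : ∀ z, ‖uI z‖ = Real.sqrt (ρ z ^ 2 + a ^ 2) * ‖RI (ρ z)‖ := fun z ↦ by
    simp only [huI, norm_mul, Complex.norm_real, Real.norm_eq_abs, abs_of_nonneg (Real.sqrt_nonneg _)]
  have hnormH : ∀ z, ‖uH z‖ = Real.sqrt (ρ z ^ 2 + a ^ 2) * ‖RH (ρ z)‖ := fun z ↦ by
    simp only [huH, norm_mul, Complex.norm_real, Real.norm_eq_abs, abs_of_nonneg (Real.sqrt_nonneg _)]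
  have huI₁ : ∀ z, uI₁ z = ((delta M a (ρ z) / (ρ z ^ 2 + a ^ 2) : ℝ) : ℂ) *
      deriv (fun s : ℝ ↦ ((Real.sqrt (s ^ 2 + a ^ 2) : ℝ) : ℂ) * RI s) (ρ z) := fun z ↦ (hSI z).2.2.2
  have huH₁ : ∀ z, uH₁ z = ((delta M a (ρ z) / (ρ z ^ 2 + a ^ 2) : ℝ) : ℂ) *
      deriv (fun s : ℝ ↦ ((Real.sqrt (s ^ 2 + a ^ 2) : ℝ) : ℂ) * RH s) (ρ z) := fun z ↦ (hSH z).2.2.2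
  /- ### far zone -/
  have hfar : ∀ z, RF ≤ ρ z → ‖uI z‖ ≤ 2 ∧ ‖uI₁ z‖ ≤ Real.sqrt 2 * ωh' := by
    intro z hz
    have hthr : max (7 * M) (max (Real.sqrt (12 * Λ) / |ω|) (1 / (M * ω ^ 2))) ≤ ρ z := by
      refine le_trans (max_le hRF7 (max_le (le_trans ?_ hRFΛ) (le_trans ?_ hRFω))) hz
      · exact div_le_div₀ (Real.sqrt_nonneg _) (Real.sqrt_le_sqrt (by linarith only [Λh])) hωl hωl'
      · have hω2' : ωl ^ 2 ≤ ω ^ 2 := by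
          rw [← sq_abs ω]; exact pow_le_pow_left₀ hωl.le hωl' 2
        exact div_le_div_of_nonneg_left zero_le_one (by positivity)
          (mul_le_mul_of_nonneg_left hω2' hM.le)
    obtain ⟨h1, h2⟩ := farEnvelope_tortoise hM ha hω0 hadm hRI hnI hρ huI₁ hthr
    rw [hnormI z]
    exact ⟨h1, h2.trans (mul_le_mul_of_nonneg_left hωh (Real.sqrt_nonneg _))⟩
  /- ### middle zone: transport from `x_F` back to `x₀ ≤ z ≤ x_F` -/
  have hcoef : ∀ z, ‖-(((ω ^ 2 - sepPotential M a ω m Λ (ρ z) : ℝ) : ℂ))‖ ≤ K ^ 2 := fun z ↦ by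
    rw [norm_neg, Complex.norm_real, Real.norm_eq_abs]
    exact (abs_omega_sq_sub_sepPotential_le hM ha.le hadm hωh Λh (hρ.rPlus_lt z).le).trans hK2
  have hlen : xF - x₀ ≤ L₀ :=
    (middleZone_length_le hM hMa hρ hℓ₀0 hℓℓ₀ hRF0 hx₀ hxF hx₀F).trans hL₀
  have hmid : ∀ z, x₀ ≤ z → z ≤ xF → ‖uI z‖ ≤ Pm ∧ ‖uI₁ z‖ ≤ Pm' := by
    intro z hz₀ hzF
    have hxF' : xF ∈ Icc x₀ (x₀ + L₀) := ⟨hx₀F.le, by linarith only [hlen]⟩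
    have hz' : z ∈ Icc x₀ (x₀ + L₀) := ⟨hz₀, by linarith only [hlen, hzF]⟩
    obtain ⟨h1, h2⟩ := Literature.Analysis.ODE.norm_le_of_norm_coeff_le_sq hL₀0 hK0
      (fun t _ ↦ ⟨(hIpair t).1, by
        have := (hIpair t).2; rwa [← neg_mul] at this⟩) (fun t _ ↦ hcoef t) hxF' hz'
    obtain ⟨hF1, hF2⟩ := hfar xF (by rw [hxF])
    rw [hE] at h1 h2
    rw [← hPm, ← hPm']
    exact ⟨h1.trans (mul_le_mul_of_nonneg_right
        (add_le_add hF1 (mul_le_mul_of_nonneg_left hF2 hL₀0.le)) hE0.le),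
      h2.trans (mul_le_mul_of_nonneg_right
        (add_le_add (mul_le_mul_of_nonneg_left hF1 hmax0) hF2) hE0.le)⟩
  /- ### horizon side: the pocket of `u_𝓗` and the conjugate-basis transfer -/
  have hpocket : ∀ z, ρ z ≤ rPlus M a + ℓ → ‖uH z‖ ≤ PH ∧ ‖uH₁ z‖ ≤ PH' := by
    intro z hz
    rw [hnormH z, ← hPH, ← hPH']
    exact horizonPocket_tortoise_lowLambda hM ha hadm Λh hΛ₁1 hc₀ hc₁ hcω hcΛ hσA hRH hnH hρ huH₁
      hratio hσσ₁ (by rw [hℓ]; linarith only [hz]) (by linarith only [hz, hℓM])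
  have hfluxH : (conj (uH x₀) * uH₁ x₀).im = -(ω - m * horizonAngularVelocity M a) := by
    have hdH : DifferentiableAt ℝ RH (ρ x₀) := by
      obtain ⟨R', R'', h⟩ := hRH
      exact (h (ρ x₀) (hρ.rPlus_lt x₀)).1.differentiableAt
    rw [huH₁ x₀]
    simp only [huH]
    rw [im_conj_schrodingerForm_mul (hρ.sq_add_sq_pos hMa x₀) hdH]
    exact Costa2019.radialFlux_eq_of_normalisedHorizon ha hRH hnH (hρ.rPlus_lt x₀)
  have hhor : ∀ z, z ≤ x₀ → ‖uI z‖ ≤ Ph := by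
    intro z hz
    have hρz : ρ z ≤ rPlus M a + ℓ := by rw [← hx₀]; exact hmono hz
    obtain ⟨hHz, -⟩ := hpocket z hρz
    obtain ⟨hH₀, hH₀'⟩ := hpocket x₀ (by rw [hx₀])
    obtain ⟨hI₀, hI₀'⟩ := hmid x₀ le_rfl hx₀F.le
    refine (norm_le_of_conjBasis hHpair hIpair hfluxH hσne z).trans ?_
    rw [← hPh]
    have hnum := add_le_add (mul_le_mul hI₀ hH₀' (norm_nonneg _) hPm0)
      (mul_le_mul hI₀' hH₀ (norm_nonneg _) hPm'0)
    exact mul_le_mul (div_le_div₀ (by positivity) hnum hσ₀0 hσε) hHz (norm_nonneg _)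
      (by positivity)
  /- ### conclusion: the three zones -/
  rw [← hx, ← hnormI x]
  rcases le_or_gt x x₀ with h₁ | h₁
  · exact (hhor x h₁).trans ((le_max_right _ _).trans (le_max_right _ _))
  rcases le_or_gt x xF with h₂ | h₂
  · exact (hmid x h₁.le h₂).1.trans ((le_max_left _ _).trans (le_max_right _ _))
  · have hz : RF ≤ ρ x := by rw [← hxF]; exact hmono h₂.le
    exact (hfar x hz).1.trans (le_max_left _ _)

/-- **Global envelope of the infinity-normalised solution at ALL bounded off-cone frequencies, uniform
up to extremality** (`s = 0`; no `m ≠ 0 ∨ 1 ≤ Λ`). For `0 < M`, `0 < ε₀`, `0 < ω_l` and any `ω_h`,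
`Λ_h` there are `a₁ < M` and `P > 0` such that for all `a₁ ≤ |a| < M`, all admissible `(ω, m, Λ)` OFF
the cone (`m = 0 ∨ ε₀|m| < |ω − mω₊|`) with `ω_l ≤ |ω| ≤ ω_h`, `Λ ≤ Λ_h`, every pair of classical
radial solutions `R_𝓗`, `R_𝓘` (`λ = Λ − a²ω²`) normalised at `𝓗⁺` resp. `𝓘⁺`, and every `r > r₊`:
`(r² + a²)^{1/2}|R_𝓘(r)| ≤ P` — superradiant or not, axisymmetric low-`Λ` included, with NO loss in `κ`.
Constants as in `Kerr.offCone_infinityEnvelope` (`σ₀ = min ε₀ ω_l`, `ω_h′ = max ω_h ω_l`,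
`Λ₁ = max Λ_h 2 ≥ 1`, …, `a₁ = √(M² − s²)`, `s = min(σ₀M²/2, M/2)`), fed into
`offCone_infinityEnvelope_of_constants_lowLambda`. [cite: DafermosRodnianskiShlapentokhrothman2014, Prop. 9.7.1] -/
theorem offCone_infinityEnvelope_all {M ε₀ ωl : ℝ} (hM : 0 < M) (hε₀ : 0 < ε₀) (hωl : 0 < ωl)
    (ωh Λh : ℝ) :
    ∃ a₁ P : ℝ, a₁ < M ∧ 0 < P ∧ ∀ a : ℝ, a₁ ≤ |a| → IsSubextremal M a →
      ∀ (ω : ℝ) (m : ℤ) (Λ : ℝ), IsAdmissibleTriple a ω m Λ →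
        (m = 0 ∨ ε₀ * |(m : ℝ)| < |ω - m * horizonAngularVelocity M a|) →
        ωl ≤ |ω| → |ω| ≤ ωh → Λ ≤ Λh →
        ∀ RH RI : ℝ → ℂ,
          IsRadialTeukolskySolution M a 0 ω m (Λ - a ^ 2 * ω ^ 2) RH →
          IsNormalisedHorizonSolution M a 0 ω m RH →
          IsRadialTeukolskySolution M a 0 ω m (Λ - a ^ 2 * ω ^ 2) RI →
          IsNormalisedInfinitySolution M 0 ω RI →
            ∀ r : ℝ, rPlus M a < r → Real.sqrt (r ^ 2 + a ^ 2) * ‖RI r‖ ≤ P := by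
  -- the constants
  set σ₀ : ℝ := min ε₀ ωl with hσ₀
  have hσ₀0 : 0 < σ₀ := lt_min hε₀ hωl
  set ωh' : ℝ := max ωh ωl with hωh'
  have hωh'0 : 0 < ωh' := hωl.trans_le (le_max_right _ _)
  set Λ₁ : ℝ := max Λh 2 with hΛ₁
  have hΛ₁1 : 1 ≤ Λ₁ := le_trans (by norm_num) (le_max_right _ _)
  have hΛ₁0 : 0 ≤ Λ₁ := zero_le_one.trans hΛ₁1
  set σ₁ : ℝ := ωh' + Real.sqrt Λ₁ / (2 * M) with hσ₁
  have hσ₁0 : 0 < σ₁ := by positivity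
  obtain ⟨c₁, hc₀, hc₁, hcω₁, hcΛ₁, hcσ₁⟩ : ∃ c₁ : ℝ, 0 < c₁ ∧ c₁ ≤ 1 ∧ 10 * M * ωh' * c₁ ≤ 1 ∧
      16 * (2 * Λ₁ + 3) * c₁ ≤ 1 ∧ 8 * M * σ₁ * c₁ ≤ 1 := by
    set c : ℝ := min (min 1 (1 / (10 * M * ωh'))) (min (1 / (16 * (2 * Λ₁ + 3))) (1 / (8 * M * σ₁)))
      with hc
    have key : ∀ {B : ℝ}, 0 < B → c ≤ 1 / B → B * c ≤ 1 := fun hB h ↦ by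
      have h' := mul_le_mul_of_nonneg_left h hB.le
      rwa [mul_one_div_cancel hB.ne'] at h'
    refine ⟨c, by positivity, (min_le_left _ _).trans (min_le_left _ _),
      key (by positivity) ((min_le_left _ _).trans (min_le_right _ _)),
      key (by positivity) ((min_le_right _ _).trans (min_le_left _ _)),
      key (by positivity) ((min_le_right _ _).trans (min_le_right _ _))⟩
  obtain ⟨P, hP, h⟩ := offCone_infinityEnvelope_of_constants_lowLambda (ωl := ωl)
    (ℓ₀ := c₁ * σ₀ * M ^ 2) (ρ₀ := (ωh' ^ 2 + 6 * Λ₁ / M ^ 2) / (σ₀ ^ 2 / 800))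
    (RF := max (7 * M) (max (Real.sqrt (12 * Λ₁) / ωl) (1 / (M * ωl ^ 2))))
    (K := Real.sqrt (ωh' ^ 2 + 3 * Λ₁ / M ^ 2 + 3 / M ^ 2))
    (L₀ := max (7 * M) (max (Real.sqrt (12 * Λ₁) / ωl) (1 / (M * ωl ^ 2))) *
      (max (7 * M) (max (Real.sqrt (12 * Λ₁) / ωl) (1 / (M * ωl ^ 2))) ^ 2 + M ^ 2) /
      (c₁ * σ₀ * M ^ 2) ^ 2)
    hM hσ₀0 hωl hωh'0 hΛ₁1 le_rfl hc₀ hc₁ hcω₁ hcΛ₁ hcσ₁ (by positivity) le_rfl le_rfl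
    (le_max_left _ _) ((le_max_left _ _).trans (le_max_right _ _))
    ((le_max_right _ _).trans (le_max_right _ _)) (Real.sqrt_nonneg _)
    (by rw [Real.sq_sqrt (by positivity)]) (by positivity) le_rfl
  -- the near-extremal threshold `a₁`
  set s : ℝ := min (σ₀ * M ^ 2 / 2) (M / 2) with hs
  have hs0 : 0 < s := lt_min (by positivity) (by positivity)
  have hsM : s ≤ M / 2 := min_le_right _ _
  have hsε : s ≤ σ₀ * M ^ 2 / 2 := min_le_left _ _
  have hMs : 0 < M ^ 2 - s ^ 2 := by nlinarith
  refine ⟨Real.sqrt (M ^ 2 - s ^ 2), P, ?_, hP, ?_⟩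
  · rw [Real.sqrt_lt' hM]
    have := pow_pos hs0 2
    linarith
  intro a ha₁a hMa ω m Λ hadm hoff hωl' hωh hΛh RH RI hRH hnH hRI hnI r hr
  have hext : 2 * Real.sqrt (M ^ 2 - a ^ 2) ≤ σ₀ * M ^ 2 := by
    have h1 : M ^ 2 - a ^ 2 ≤ s ^ 2 := by
      have h2 : Real.sqrt (M ^ 2 - s ^ 2) ^ 2 ≤ |a| ^ 2 :=
        pow_le_pow_left₀ (Real.sqrt_nonneg _) ha₁a 2
      rw [Real.sq_sqrt hMs.le, sq_abs] at h2
      linarith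
    have h3 : Real.sqrt (M ^ 2 - a ^ 2) ≤ s := by
      rw [← Real.sqrt_sq hs0.le]; exact Real.sqrt_le_sqrt h1
    linarith
  -- the floor of `|σ|`
  have hfloor : σ₀ ≤ |ω - m * horizonAngularVelocity M a| := by
    rcases eq_or_ne m 0 with hm | hm
    · rw [hm, Int.cast_zero, zero_mul, sub_zero]
      exact (min_le_right _ _).trans hωl'
    · have hm1 : (1 : ℝ) ≤ |(m : ℝ)| := by exact_mod_cast Int.one_le_abs hm
      have hoff' := hoff.resolve_left hm
      exact (min_le_left _ _).trans ((le_mul_of_one_le_right hε₀.le hm1).trans hoff'.le)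
  exact h a hMa hext ω m Λ hadm hfloor hωl' (hωh.trans (le_max_left _ _))
    (hΛh.trans (le_max_left _ _)) RH RI hRH hnH hRI hnI r hr

/-- **The axisymmetric low-`Λ` window** (`m = 0`, `ω_l ≤ |ω| ≤ ω_h`, `0 ≤ Λ < 1`, `a₁ ≤ |a| < M`): the
global κ-uniform envelope `(r² + a²)^{1/2}|R_𝓘(r)| ≤ P` for ALL `r > r₊` and every normalised pair — the
statement `AxisymmetricLowLambdaEnvelope` of the S6a′ skeleton of crux `KappaExplicitWaveDecay`, verbatim
(`offCone_infinityEnvelope_all` at `m = 0`, `ε₀ = 1`, `Λ_h = 1`; for `m = 0` every triple is off the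
cone). [cite: DafermosRodnianskiShlapentokhrothman2014, Prop. 9.7.1] -/
theorem axisymmetricLowLambda_infinityEnvelope :
    ∀ M : ℝ, 0 < M → ∀ ωl ωh : ℝ, 0 < ωl →
    ∃ (a₁ P : ℝ), a₁ < M ∧ 0 < P ∧
    ∀ a : ℝ, a₁ ≤ |a| → IsSubextremal M a →
    ∀ (ω Λ : ℝ), IsAdmissibleTriple a ω 0 Λ → Λ < 1 → ωl ≤ |ω| → |ω| ≤ ωh →
      ∀ RH RI : ℝ → ℂ,
        IsRadialTeukolskySolution M a 0 ω ((0 : ℤ) : ℝ) (Λ - a ^ 2 * ω ^ 2) RH →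
        IsNormalisedHorizonSolution M a 0 ω ((0 : ℤ) : ℝ) RH →
        IsRadialTeukolskySolution M a 0 ω ((0 : ℤ) : ℝ) (Λ - a ^ 2 * ω ^ 2) RI →
        IsNormalisedInfinitySolution M 0 ω RI →
          ∀ r : ℝ, rPlus M a < r → Real.sqrt (r ^ 2 + a ^ 2) * ‖RI r‖ ≤ P := by
  intro M hM ωl ωh hωl
  obtain ⟨a₁, P, ha₁, hP, h⟩ := offCone_infinityEnvelope_all hM one_pos hωl ωh 1
  refine ⟨a₁, P, ha₁, hP, ?_⟩
  intro a ha hMa ω Λ hadm hΛ hωl' hωh RH RI hRH hnH hRI hnI r hr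
  exact h a ha hMa ω 0 Λ hadm (Or.inl rfl) hωl' hωh hΛ.le RH RI hRH hnH hRI hnI r hr

end Literature.Geometry.Lorentzian.Kerr

end
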